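import Summits.AnomalousDissipation.AnomalousDissipation.Theses.MomentParity
import Summits.AnomalousDissipation.AnomalousDissipation.Theorems.QuarticGate.Negative.LevelCeiling
import Summits.AnomalousDissipation.AnomalousDissipation.Theorems.QuarticGate.Negative.EnergyRow
import Summits.AnomalousDissipation.AnomalousDissipation.Theorems.QuarticGate.Negative.Laminar
import Summits.AnomalousDissipation.AnomalousDissipation.Theorems.MomentParityQuarticGateSignLemma
import Summits.AnomalousDissipation.AnomalousDissipation.Theorems.MomentParityQuarticGateSurgery
import Summits.AnomalousDissipation.AnomalousDissipation.Theorems.MomentParityQuarticGateStubOrder3SurgerySym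
import Summits.AnomalousDissipation.AnomalousDissipation.Theorems.MomentParityQuarticGateStubOrder2DesignSym
import Summits.AnomalousDissipation.AnomalousDissipation.Theorems.MomentParityQuarticGateStubAxialDefect
import Summits.AnomalousDissipation.AnomalousDissipation.Theorems.MomentParityQuarticGateStubAxialDefectCertificate
import Summits.AnomalousDissipation.AnomalousDissipation.Theorems.MomentParityQuarticGateCubicAssembly
import Literature.Analysis.FluidPDE.BeltramiWavesCurl
import Mathlib.NumberTheory.SumTwoSquares

/-!
# Line `axis-sectors` for crux `MomentParity.QuarticGate` (stmt-AnomalousDissipation-11464)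

crux-plan (opening, round 1), planner-cruxplan-stmt-AnomalousDissipation-11464-axis-sectors-0,
2026-08-16. Idea card `Cruxes/QuarticGate/Ideas/axis-sectors.md` (crux-ideate r1, ideator 3);
triage r1-2 **pass**, r1-3 **pass** (sharpenings adopted, see `Lines/axis-sectors.md`).

## The line in one paragraph

Run the picked line `recession-cone` (lead's skeleton `Lines/recession-cone.lean`, stubs S1–S6)
EQUIVARIANTLY under the shear symmetry group `G′ = {a : T³ | a 1 = 0}` (translations in `x₀, x₂`,
which fix the Kolmogorov force `f = sin(2π x₁) e₀`). For a law `μ` whose cylindrical statistics are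
invariant under (a finite subgroup `H_L = {a | a 1 = 0, L • a = 0}`, `L > 3N`, of) `G′` and a
`G′`-invariant `f`, every generator row is an invariant linear functional of the test observable, so
it only sees the AXIAL momentum sectors `θ ∈ ℤ e₁`; the cone/range dualities of S3 and S5 then run
inside the invariant sub-algebra and the ONLY Casimir input left is axial:
`stub_axialQuadRigidity` (every shear-invariant quadratic Casimir of level-`N` Galerkin–Euler is
`αE + βH`, all `N ≥ 2`) and `stub_noAxialCubicCasimir` (no shear-invariant cubic Casimir, frequently
in `N`) — in place of the lead's `stub_casimirs : ∃ᶠ N, NoCubicCasimir N ∧ QuadRigidity N` over all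
sectors `θ ∈ ℤ³`. On the axis two-sided peeling never stalls: the only unreachable configuration of
a momentum chain is an equilateral pair, and `a² + b² = 3j²` has no integer solution with `j ≠ 0`
(`noEquilateralOnAxis`, PROVED below, A0 of the card).

## Stubs (7) and composition

* `stub_order2DesignSym`  (S6′) explicit `G′`-symmetric loud order-2 Kolmogorov design, `H_L`-invariant
  cylindrical laws for every requested `L` — the lead's S6 with symmetric jitter / orbit-symmetrised atoms.
* `stub_axialQuadRigidity` (S2q) axial QuadRigidity, all `N ≥ 2` (A1 ∧ A2 of the card).
* `stub_axialDefect`       (S5a, THE LEVER at order 2) symmetric `μ₀`, symmetric `f`, energy + helicity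
  rows, axial QuadRigidity ⟹ the row of EVERY quadratic Casimir vanishes.
* `stub_order3SurgerySym`  (S5b) the lead's S5 with a CASIMIR-FREE interface (hypothesis: all quadratic
  Casimir rows vanish) and symmetry carried through (`μ₁` again `H_L`-invariant).
* `stub_noAxialCubicCasimir` (S2c) no axial cubic Casimir, `∃ᶠ N` (A3 of the card; the conjectural stub).
* `stub_axialDefectCertificate` (S3′, THE LEVER at order 3) symmetric `μ`, symmetric `f`, no axial cubic
  Casimir ⟹ a PLAIN defect certificate (finitely many level-`N` atoms), via the landed sign lemma
  `MomentParityQuarticGate.stub_signLemma` (S1, PROVED in tree) and de-averaging of orbit atoms.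
* `stub_surgery`           (S4) VERBATIM the lead's registered stub (shared).
* `QuarticGate_of`: `ν_j := ν₀/(j+2)`; at level `N` with `N ≥ N₀(ν_j)`, `N ≥ 2`, no axial cubic Casimir
  (`Frequently.and_eventually`), `L := 3N+1`: S6′ → S2q → S5a → S5b → S3′(S2c) → S4. Kernel-checked, no
  sorry of its own; concludes `MomentParity.QuarticGate` by name.

Vocabulary: `IsLevel / IsBandTest / polyGrad / IsPolyStationary` of
`Theorems/QuarticGate/Negative/LevelCeiling.lean` (landed, definitional unfoldings of the crux clauses;
the lead's restated S5 uses the same). Inlined clause shapes (no local definitions, so every stub lands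
verbatim as a `Theorems/MomentParityQuarticGate…` file):
* `ShearSym f`   := `∀ a : T³, a 1 = 0 → ∀ x, f (x + a) = f x`;
* `LawSym N L μ` := `∀ a, a 1 = 0 → L • a = 0 → ∀ m g, (∀ i, IsBandTest N (g i)) →
     map (u ↦ ((u, gᵢ(· + a)))ᵢ) μ = map (u ↦ ((u, gᵢ))ᵢ) μ` (cylindrical `H_L`-invariance in law;
     `(u, g(·+a)) = (τ₋ₐu, g)`, so this is invariance of `μ` seen through level-`N` statistics);
* `AxialObs N L g P` := `∀ a, a 1 = 0 → L • a = 0 → ∀ u, IsLevel N u → P((u, gⱼ(·+a))ⱼ) = P((u,gⱼ)ⱼ)`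
     (an observable on `V_N` invariant under the finite shear subgroup `H_L`; for a level-`N`
     observable of degree `d` and `L > dN` this is the SAME as invariance under all of `G′` — no
     aliasing, its momentum sectors have `|θ₀|, |θ₂| ≤ dN < L` — i.e. support in the axial sectors
     `(0,m,0)`; the Casimir stubs S2q/S2c are stated in this form so that the Fourier/Nyquist
     bookkeeping lives with them and their consumers S5a/S3′ stay Fourier-free);
* `Casimir N g P` := `∀ u, IsLevel N u → nsGeneratorPairing 0 0 u (polyGrad g P u) = 0`.

Disproof.lean (cdisprove g2 cycle 2, 1924 lines, sections A–J) READ at start and before publishing: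
honours (A) level ceiling (`IsQuarticWitness.eps_le`, `not_quarticGateBoundedLevel`: witness levels
`N ≥ N₀(ν_j) ≍ ν_j^{-1/2}`, unbounded — the `∃ᶠ N` of `QuarticGate_of`), (B)/(D)/(F) load-bearing clauses
untouched (same `f ≠ 0`, `E`, `ε > 0`, `ν_j → 0`), (C) energy row / force floor (the energy row is one of
the two Casimir rows S6′ keeps; `ε = 1/4 ≤ ‖f‖√E = 1`), (J) momentum row (`force_sq_le_of_momentumRow`:
`E ≥ 1/(4π) − o(1)` for this force — S6′'s design energy `≈ 0.6`), §G (S2 is the only conjectural content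
of the picked line — this line shrinks exactly S2; its S5 remark "Slater point needs a density / ≳ n²/2
atoms" is inherited by S5b, and orbit-symmetrisation only adds atoms), §H level one inert
(`not_noCubicCasimir_one`, `not_quadRigidity_one`: S2q carries `2 ≤ N`, S2c is `∃ᶠ N`, the composition
adds `eventually (2 ≤ N)`), §I the honest gate `QuarticGateSupported` (support radius before `∃ᶠ N`):
NOT evidently reached by this line either — like the picked line it decides the TYPED crux through far
atoms chosen after `N` (caveat recorded in `Lines/axis-sectors.md` § Barriers; the crux is fixed for this
seat). No `_false_without_` theorem / Targets posted. ALL landed negative lemmas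
`Theorems/QuarticGate/Negative/{LevelCeiling,EnergyRow,Laminar}` are IMPORTED here (scratch check =
this file; `FixedViscosity`, `LevelOne`, `MomentumRow` READ but not yet built on the farm at planning
time, so not importable yet): no stub is an instance of a statement they refute (they refute
`QuarticGateBoundedLevel`, `QuarticGateEveryForce`, `QuarticGateSubFloor`, `NoCubicCasimir 1`,
`QuadRigidity 1` and exhibit the laminar/fixed-viscosity families; S2q/S2c live at `N ≥ 2` / `∃ᶠ N`).
-/

namespace Summit.AnomalousDissipation.AnomalousDissipation.Cruxes.QuarticGate.AxisSectors

open MeasureTheory Filter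
open Literature.Analysis.FunctionSpaces Literature.Analysis.FluidPDE
open Summit.AnomalousDissipation.AnomalousDissipation.Theses.MomentParity
open Summit.AnomalousDissipation.AnomalousDissipation.Theorems.QuarticGate.Negative

set_option linter.dupNamespace false

/-! ## A0 — the arithmetic no-stall lemma of the axis (PROVED; not a stub) -/

/-- **A0 — no equilateral pair on the axis.** `a² + b² = 3 j²` has no integer solution with `j ≠ 0`:
`v₃(a² + b²)` is even for a sum of two squares (`Nat.eq_sq_add_sq_iff`, `3 % 4 = 3`) while
`v₃(3 j²) = 1 + 2 v₃(j)` is odd. On the momentum pencil `θ = m e₁` an equilateral pair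
`k₁ + k₂ = θ`, `|k₁| = |k₂| = |θ|` needs `k₁ = (a, m/2, b)` with `a² + b² = 3 (m/2)²`, so it does not
exist: the only configuration that two-sided peeling of a momentum chain cannot reach (card, NOTES F6′;
re-derived by this planner, `Lines/axis-sectors.md` § Planner re-derivation) never occurs in an axial
sector — the combinatorial reason `stub_axialQuadRigidity` has an all-`N` proof path. [folklore] -/
theorem noEquilateralOnAxis : ∀ j a b : ℤ, a ^ 2 + b ^ 2 = 3 * j ^ 2 → j = 0 := by
  intro j a b h
  by_contra hj
  -- pass to natural numbers
  have hN : a.natAbs ^ 2 + b.natAbs ^ 2 = 3 * j.natAbs ^ 2 := by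
    have h2 := congrArg Int.natAbs h
    rw [Int.natAbs_add_of_nonneg (sq_nonneg a) (sq_nonneg b)] at h2
    simpa [Int.natAbs_mul, Int.natAbs_pow] using h2
  have hj' : j.natAbs ≠ 0 := by simpa using hj
  set n : ℕ := 3 * j.natAbs ^ 2 with hn
  have hn0 : n ≠ 0 := Nat.mul_ne_zero (by norm_num) (pow_ne_zero 2 hj')
  have h3 : (3 : ℕ) ∈ n.primeFactors :=
    Nat.mem_primeFactors.mpr ⟨Nat.prime_three, ⟨j.natAbs ^ 2, hn⟩, hn0⟩
  have heven : Even (padicValNat 3 n) :=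
    (Nat.eq_sq_add_sq_iff.mp ⟨a.natAbs, b.natAbs, hN.symm⟩) 3 h3 (by norm_num)
  have hodd : padicValNat 3 n = 1 + 2 * padicValNat 3 j.natAbs := by
    haveI : Fact (Nat.Prime 3) := ⟨Nat.prime_three⟩
    rw [hn, padicValNat.mul (by norm_num) (by positivity), padicValNat_self, padicValNat.pow]
  rw [hodd] at heven
  rcases heven with ⟨r, hr⟩
  omega

/-! ## The stubs -/

/-- **S6′ — THE SYMMETRIC ORDER-2 DESIGN, ONE EXPLICIT FORCE (the lead's S6 in the
`G′`-invariant category; r1-3 sharpening).** Kolmogorov force `f = sin(2π x₁) e₀` (so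
`f (x + a) = f x` whenever `a 1 = 0`), `E = 2`, `ε = 1/4`, `ν₀` small: for every `ν ∈ (0, ν₀)` there is
`N₀ = K(ν) + 2`, `K(ν) ≍ ν^{-1/2}`, such that for EVERY `N ≥ N₀` and every symmetry order `L ≥ 1` a
level-`N` probability law `μ₀` with bounded support and nondegenerate covariance has `H_L`-INVARIANT
cylindrical statistics (`LawSym N L μ₀`), all LINEAR rows exact, the ENERGY row exact, the HELICITY row
exact, energy `≤ E`, dissipation `≥ ε`. Why true: the lead's design
`u = U₀ sin(2πy)e₀ + A cos(2πKz+θ) + B cos(2π(Kz+y)+θ) + jitter` (cdisprove §G verified its rows: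
mean row `(1 − 4π²νU₀ + πA₁B₂) f = 0`, energy row by IVT, helicity row termwise) is already
`x`- and `z`-homogeneous up to the jitter; make the jitter rotation-invariant per wavevector, or — for a
finitely atomic realisation — replace every atom `v` by its `H_L`-orbit `{τ_a v}` (`L²` translates):
translates of level-`N` fields are level-`N`, linear rows become rows of translated band tests (all
zero), `E`/`H` rows, energy, dissipation and support are translation invariant, the covariance of the
mixture dominates the orbit average of the covariances (still nondegenerate). Size L (explicit
trigonometric bookkeeping + a pushforward/atomic measure; the lead's AtomRows/DesignSums/ModeCalculus
helpers apply, plus `mFourierCoeff` of a translate = character × coefficient). -/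
theorem stub_order2DesignSym :
    ∃ f : UnitAddTorus (Fin 3) → EuclideanSpace ℝ (Fin 3),
    Torus.IsSmooth f ∧ Torus.IsDivFree f ∧ Torus.HasZeroMean f ∧
    (∀ a : UnitAddTorus (Fin 3), a 1 = 0 → ∀ x, f (x + a) = f x) ∧
    ∃ E ε ν₀ : ℝ, 0 < ε ∧ 0 < ν₀ ∧ ∀ ν : ℝ, 0 < ν → ν < ν₀ → ∃ N₀ : ℕ, ∀ N : ℕ, N₀ ≤ N →
    ∀ L : ℕ, 0 < L →
    ∃ μ₀ : Measure (Torus.energySpace (Fin 3)), IsProbabilityMeasure μ₀ ∧ (∀ᵐ u ∂μ₀, IsLevel N u) ∧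
    (∃ R : ℝ, ∀ᵐ u ∂μ₀, ‖u‖ ≤ R) ∧
    (∀ g : UnitAddTorus (Fin 3) → EuclideanSpace ℝ (Fin 3), IsBandTest N g →
      (∃ u : Torus.energySpace (Fin 3), IsLevel N u ∧ Torus.pairing u.1 g ≠ 0) →
      (∫ u : Torus.energySpace (Fin 3), Torus.pairing u.1 g ∂μ₀) ^ 2 <
        ∫ u : Torus.energySpace (Fin 3), (Torus.pairing u.1 g) ^ 2 ∂μ₀) ∧
    (∀ a : UnitAddTorus (Fin 3), a 1 = 0 → L • a = 0 →
      ∀ (m : ℕ) (g : Fin m → UnitAddTorus (Fin 3) → EuclideanSpace ℝ (Fin 3)),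
      (∀ i, IsBandTest N (g i)) →
      Measure.map (fun u : Torus.energySpace (Fin 3) => fun i => Torus.pairing u.1 (fun x => g i (x + a))) μ₀ =
        Measure.map (fun u : Torus.energySpace (Fin 3) => fun i => Torus.pairing u.1 (g i)) μ₀) ∧
    (∀ g : UnitAddTorus (Fin 3) → EuclideanSpace ℝ (Fin 3), IsBandTest N g →
      Integrable (fun u : Torus.energySpace (Fin 3) => Torus.nsGeneratorPairing ν f u g) μ₀ ∧
      ∫ u : Torus.energySpace (Fin 3), Torus.nsGeneratorPairing ν f u g ∂μ₀ = 0) ∧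
    (Integrable (fun u : Torus.energySpace (Fin 3) => Torus.nsGeneratorPairing ν f u
        (Torus.fourierTruncate N (u.1 : UnitAddTorus (Fin 3) → EuclideanSpace ℝ (Fin 3)))) μ₀ ∧
      ∫ u : Torus.energySpace (Fin 3), Torus.nsGeneratorPairing ν f u
        (Torus.fourierTruncate N (u.1 : UnitAddTorus (Fin 3) → EuclideanSpace ℝ (Fin 3))) ∂μ₀ = 0) ∧
    (Integrable (fun u : Torus.energySpace (Fin 3) => Torus.nsGeneratorPairing ν f u
        (BDSV.curl (Torus.fourierTruncate N (u.1 : UnitAddTorus (Fin 3) → EuclideanSpace ℝ (Fin 3))))) μ₀ ∧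
      ∫ u : Torus.energySpace (Fin 3), Torus.nsGeneratorPairing ν f u
        (BDSV.curl (Torus.fourierTruncate N (u.1 : UnitAddTorus (Fin 3) → EuclideanSpace ℝ (Fin 3)))) ∂μ₀ = 0) ∧
    Torus.ensembleEnergy μ₀ ≤ E ∧ ε ≤ Torus.ensembleDissipation ν μ₀ :=
  Summit.AnomalousDissipation.AnomalousDissipation.Theorems.MomentParityQuarticGate.stub_order2DesignSym

/-- **S2q — AXIAL QUADRATIC RIGIDITY, all levels `N ≥ 2` (A1 ∧ A2 of the card; replaces conjunct
(ii) `QuadRigidity N` of the lead's `stub_casimirs`).** Every SHEAR-INVARIANT homogeneous quadratic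
Casimir of level-`N` Galerkin–Euler (`{p,B_N} ≡ 0` on `V_N`, `p` invariant under the finite shear
translations `H_L = {a | a 1 = 0, L • a = 0}` for some `L > 2N` — by Nyquist (`|θ₀|, |θ₂| ≤ 2N < L`)
the same as invariance under all of `G′`, i.e. support in the axial momentum sectors `θ = (0,m,0)`;
this Fourier bookkeeping is part of the stub) is `α|u|² + β(u, curl u)` on `V_N`, stated through its
gradient `∇p(u) = 2α P_N u + 2β curl P_N u`.
Why plausibly true: (A1, off-centre axial sectors `m ≠ 0` are EMPTY) momentum grading + two-sided
peeling along the chains `{ℓ_j, θ − ℓ_j}`, `ℓ_j = r + jθ`: a link `ℓ` conducts in both directions iff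
`|ℓ| ≠ |θ|` (outer-layer/link injectivity: `span{P_{θ−r}[(a·s)w + (w·s)a]} = (θ−r)^⊥` iff `|r| ≠ |θ|`,
`s = θ − r`, re-derived by this planner), a non-collinear chain has two bad links only if they are
consecutive (an equilateral pair), impossible on the axis by `noEquilateralOnAxis`; collinear pairs are
pinned through one non-degenerate triad `p + q = jθ`; (A2, centre sector) Kraichnan's per-triad
detailed conservation in the helical basis (`e_±(k) = α ± β|k|`) once lattice triads connect the ball
(`N ≥ 2`). FALSE at `N = 1` (`not_quadRigidity_one`: `B_1 ≡ 0`), hence `2 ≤ N`. Exact evidence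
(item): `G′`-invariant quadratic Casimirs have dimension exactly 2 at every computed level — sectors
`(0,m,0)`, `m = 1..4`, nullity 0 and centre nullity 2 for `0<|k|² ≤ M`, `M = 3..16`, and
`m ≤ 2`, `M ≤ 25` (kit j012002, ball_casimirs.py, two primes; j011010 SVD) — complete for `N = 2, 3`.
Size L (combinatorial linear algebra over `Torus.freqBall`; `convectionCoeff`,
`inertialPairing_eq_sum_convectionCoeff` of Disproof §H, `curl_realTrigPoly`). -/
theorem stub_axialQuadRigidity :
    ∀ N : ℕ, 2 ≤ N → ∀ L : ℕ, 2 * N < L →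
    ∀ (m : ℕ) (g : Fin m → UnitAddTorus (Fin 3) → EuclideanSpace ℝ (Fin 3))
      (P : MvPolynomial (Fin m) ℝ), (∀ i, IsBandTest N (g i)) → P.IsHomogeneous 2 →
      (∀ a : UnitAddTorus (Fin 3), a 1 = 0 → L • a = 0 → ∀ u : Torus.energySpace (Fin 3), IsLevel N u →
        MvPolynomial.eval (fun j => Torus.pairing u.1 (fun x => g j (x + a))) P =
          MvPolynomial.eval (fun j => Torus.pairing u.1 (g j)) P) →
      (∀ u : Torus.energySpace (Fin 3), IsLevel N u →
        Torus.nsGeneratorPairing (d := Fin 3) 0 0 u (polyGrad g P u) = 0) →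
      ∃ α β : ℝ, ∀ u : Torus.energySpace (Fin 3), IsLevel N u →
        ∀ x, polyGrad g P u x =
          (2 * α) • Torus.fourierTruncate N (u.1 : UnitAddTorus (Fin 3) → EuclideanSpace ℝ (Fin 3)) x +
          (2 * β) • BDSV.curl (Torus.fourierTruncate N
            (u.1 : UnitAddTorus (Fin 3) → EuclideanSpace ℝ (Fin 3))) x := by
  sorry

/-- **S5a — THE LEVER AT ORDER 2: a shear-symmetric law only sees axial quadratic Casimirs.**
Let `f` be smooth and `G′`-invariant, `μ₀` a level-`N` probability law with bounded support whose
cylindrical statistics are `H_L`-invariant for some `L > 2N`, whose ENERGY row and HELICITY row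
vanish, at a level where axial QuadRigidity (S2q's conclusion, as a hypothesis) holds. Then the row of
EVERY homogeneous quadratic Casimir `p₂` (all momentum sectors) vanishes.
Why true: average `p₂` over `H_L`: `p̄₂ = L⁻² Σ_{a ∈ H_L} p₂ ∘ τ_a` is again a homogeneous quadratic
band observable (band space is translation invariant; re-expand over a band basis,
`exists_bandBasis` / `polyGrad_transport` landed) and again a Casimir (`B_N` commutes with
translations), and `H_L`-invariant by construction, so by axial QuadRigidity (hypothesis, in its
`H_L`-form, `L > 2N`) `∇p̄₂ = 2αP_N u + 2β curl P_N u` and `row(p̄₂) = 2α·(energy row) + 2β·(helicity row) = 0`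
(`nsGeneratorPairing_sum_smul`); and `row_{μ₀}(p₂ ∘ τ_a) = row_{μ₀}(p₂)` for each `a ∈ H_L` (law
invariance + `F(τ_a u) = τ_a F(u)` for `G′`-invariant `f`; in band coordinates the row is the integral
of a fixed polynomial against an `H_L`-invariant coordinate law, `exists_rowPoly` landed), whence
`row(p₂) = row(p̄₂) = 0`. Only the `L²` translations of `H_L` are used (no Haar integral, no Fourier analysis). Integrability:
bounded support, continuous integrand. Size M. -/
theorem stub_axialDefect :
    ∀ (ν : ℝ) (f : UnitAddTorus (Fin 3) → EuclideanSpace ℝ (Fin 3)) (N L : ℕ)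
      (μ₀ : Measure (Torus.energySpace (Fin 3))),
    Torus.IsSmooth f → (∀ a : UnitAddTorus (Fin 3), a 1 = 0 → ∀ x, f (x + a) = f x) → 2 * N < L →
    IsProbabilityMeasure μ₀ → (∀ᵐ u ∂μ₀, IsLevel N u) → (∃ R : ℝ, ∀ᵐ u ∂μ₀, ‖u‖ ≤ R) →
    (∀ a : UnitAddTorus (Fin 3), a 1 = 0 → L • a = 0 →
      ∀ (m : ℕ) (g : Fin m → UnitAddTorus (Fin 3) → EuclideanSpace ℝ (Fin 3)),
      (∀ i, IsBandTest N (g i)) →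
      Measure.map (fun u : Torus.energySpace (Fin 3) => fun i => Torus.pairing u.1 (fun x => g i (x + a))) μ₀ =
        Measure.map (fun u : Torus.energySpace (Fin 3) => fun i => Torus.pairing u.1 (g i)) μ₀) →
    (Integrable (fun u : Torus.energySpace (Fin 3) => Torus.nsGeneratorPairing ν f u
        (Torus.fourierTruncate N (u.1 : UnitAddTorus (Fin 3) → EuclideanSpace ℝ (Fin 3)))) μ₀ ∧
      ∫ u : Torus.energySpace (Fin 3), Torus.nsGeneratorPairing ν f u
        (Torus.fourierTruncate N (u.1 : UnitAddTorus (Fin 3) → EuclideanSpace ℝ (Fin 3))) ∂μ₀ = 0) →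
    (Integrable (fun u : Torus.energySpace (Fin 3) => Torus.nsGeneratorPairing ν f u
        (BDSV.curl (Torus.fourierTruncate N (u.1 : UnitAddTorus (Fin 3) → EuclideanSpace ℝ (Fin 3))))) μ₀ ∧
      ∫ u : Torus.energySpace (Fin 3), Torus.nsGeneratorPairing ν f u
        (BDSV.curl (Torus.fourierTruncate N (u.1 : UnitAddTorus (Fin 3) → EuclideanSpace ℝ (Fin 3)))) ∂μ₀ = 0) →
    (∀ (m : ℕ) (g : Fin m → UnitAddTorus (Fin 3) → EuclideanSpace ℝ (Fin 3))
      (P : MvPolynomial (Fin m) ℝ), (∀ i, IsBandTest N (g i)) → P.IsHomogeneous 2 →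
      (∀ a : UnitAddTorus (Fin 3), a 1 = 0 → L • a = 0 → ∀ u : Torus.energySpace (Fin 3), IsLevel N u →
        MvPolynomial.eval (fun j => Torus.pairing u.1 (fun x => g j (x + a))) P =
          MvPolynomial.eval (fun j => Torus.pairing u.1 (g j)) P) →
      (∀ u : Torus.energySpace (Fin 3), IsLevel N u →
        Torus.nsGeneratorPairing (d := Fin 3) 0 0 u (polyGrad g P u) = 0) →
      ∃ α β : ℝ, ∀ u : Torus.energySpace (Fin 3), IsLevel N u →
        ∀ x, polyGrad g P u x =
          (2 * α) • Torus.fourierTruncate N (u.1 : UnitAddTorus (Fin 3) → EuclideanSpace ℝ (Fin 3)) x +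
          (2 * β) • BDSV.curl (Torus.fourierTruncate N
            (u.1 : UnitAddTorus (Fin 3) → EuclideanSpace ℝ (Fin 3))) x) →
    ∀ (m : ℕ) (g : Fin m → UnitAddTorus (Fin 3) → EuclideanSpace ℝ (Fin 3))
      (P : MvPolynomial (Fin m) ℝ), (∀ i, IsBandTest N (g i)) → P.IsHomogeneous 2 →
      (∀ u : Torus.energySpace (Fin 3), IsLevel N u →
        Torus.nsGeneratorPairing (d := Fin 3) 0 0 u (polyGrad g P u) = 0) →
      Integrable (fun u : Torus.energySpace (Fin 3) => Torus.nsGeneratorPairing ν f u (polyGrad g P u)) μ₀ ∧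
      ∫ u, Torus.nsGeneratorPairing ν f u (polyGrad g P u) ∂μ₀ = 0 :=
  Summit.AnomalousDissipation.AnomalousDissipation.Theorems.MomentParityQuarticGate.stub_axialDefect

/-- **S5b — ORDER-3 SURGERY + SLATER UPGRADE, CASIMIR-FREE AND SYMMETRIC — CLOSED: now the landed theorem
`MomentParityQuarticGate.stub_order3SurgerySym` (Theorems/MomentParityQuarticGateStubOrder3SurgerySym.lean, p85840). (The lead's S5 with its
Casimir hypothesis replaced by what its kernel step consumes, and the symmetry carried through).**
A level-`N` probability law `μ₀` with bounded support, NONDEGENERATE covariance on `V_N` and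
`H_L`-invariant cylindrical statistics, whose LINEAR rows vanish and whose row vanishes on EVERY
homogeneous quadratic Casimir (S5a's conclusion), for a smooth `G′`-invariant force ⟹ a level-`N` law
`μ₁` with finite fourth moments, Slater at degree 4, 3-STATIONARY, again `H_L`-invariant, with the same
mean energy and dissipation.
Why true: exactly the lead's pipeline (Rows → Fatten → QuadRange → Kernel → LambdaPositivity →
Realize → Assembly, all landed as `--supports`): the quadratic-row vector `a` kills `ker cᵀ` =
quadratic Casimirs in band coordinates BY HYPOTHESIS (this is the only place the lead used
QuadRigidity + the `E`/`H` rows), so `a = c s`, the shift `S = −s` of `M₃` kills every quadratic row,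
`y_Λ = (1, M₁, M₂, M₃ + S, Λ M₄^{fat})` is strictly positive for `Λ ≫ 1`, REALIZE it (Fialkow–Nie
Thm 1.3, PROVED: `FialkowNie2010_thm_1_3_holds`; with a density / enough generic atoms, cdisprove §G
remark). SYMMETRY: replace the realised atoms `xᵢ` (band coordinates) by their `H_L`-orbits `ρ(a)xᵢ`
(`exists_level_of_coords`): the moment vector becomes the `H_L`-average `ȳ_Λ`, which still kills every
row of degree `≤ 2` (rows of translated tests, `f` invariant), is still strictly positive (convexity),
and agrees with `y_Λ` up to degree 2 (`μ₀` is `H_L`-invariant) — so energy, dissipation, linear rows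
are unchanged and `LawSym N L μ₁` holds. Size L–XL (the lead's S5, ≈ landed) + M (symmetrisation). -/
theorem stub_order3SurgerySym :
    ∀ (ν : ℝ) (f : UnitAddTorus (Fin 3) → EuclideanSpace ℝ (Fin 3)) (N L : ℕ)
      (μ₀ : Measure (Torus.energySpace (Fin 3))),
    Torus.IsSmooth f → (∀ a : UnitAddTorus (Fin 3), a 1 = 0 → ∀ x, f (x + a) = f x) → 0 < L →
    IsProbabilityMeasure μ₀ → (∀ᵐ u ∂μ₀, IsLevel N u) → (∃ R : ℝ, ∀ᵐ u ∂μ₀, ‖u‖ ≤ R) →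
    (∀ g : UnitAddTorus (Fin 3) → EuclideanSpace ℝ (Fin 3), IsBandTest N g →
      (∃ u : Torus.energySpace (Fin 3), IsLevel N u ∧ Torus.pairing u.1 g ≠ 0) →
      (∫ u : Torus.energySpace (Fin 3), Torus.pairing u.1 g ∂μ₀) ^ 2 <
        ∫ u : Torus.energySpace (Fin 3), (Torus.pairing u.1 g) ^ 2 ∂μ₀) →
    (∀ a : UnitAddTorus (Fin 3), a 1 = 0 → L • a = 0 →
      ∀ (m : ℕ) (g : Fin m → UnitAddTorus (Fin 3) → EuclideanSpace ℝ (Fin 3)),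
      (∀ i, IsBandTest N (g i)) →
      Measure.map (fun u : Torus.energySpace (Fin 3) => fun i => Torus.pairing u.1 (fun x => g i (x + a))) μ₀ =
        Measure.map (fun u : Torus.energySpace (Fin 3) => fun i => Torus.pairing u.1 (g i)) μ₀) →
    (∀ g : UnitAddTorus (Fin 3) → EuclideanSpace ℝ (Fin 3), IsBandTest N g →
      Integrable (fun u : Torus.energySpace (Fin 3) => Torus.nsGeneratorPairing ν f u g) μ₀ ∧
      ∫ u : Torus.energySpace (Fin 3), Torus.nsGeneratorPairing ν f u g ∂μ₀ = 0) →
    (∀ (m : ℕ) (g : Fin m → UnitAddTorus (Fin 3) → EuclideanSpace ℝ (Fin 3))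
      (P : MvPolynomial (Fin m) ℝ), (∀ i, IsBandTest N (g i)) → P.IsHomogeneous 2 →
      (∀ u : Torus.energySpace (Fin 3), IsLevel N u →
        Torus.nsGeneratorPairing (d := Fin 3) 0 0 u (polyGrad g P u) = 0) →
      ∫ u, Torus.nsGeneratorPairing ν f u (polyGrad g P u) ∂μ₀ = 0) →
    ∃ μ₁ : Measure (Torus.energySpace (Fin 3)), IsProbabilityMeasure μ₁ ∧ (∀ᵐ u ∂μ₁, IsLevel N u) ∧
      Integrable (fun u : Torus.energySpace (Fin 3) => ‖u‖ ^ 4) μ₁ ∧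
      (∀ (m : ℕ) (g : Fin m → UnitAddTorus (Fin 3) → EuclideanSpace ℝ (Fin 3))
        (P : MvPolynomial (Fin m) ℝ), (∀ i, IsBandTest N (g i)) → P.totalDegree ≤ 4 →
        (∀ u : Torus.energySpace (Fin 3), IsLevel N u →
          0 ≤ MvPolynomial.eval (fun j => Torus.pairing u.1 (g j)) P) →
        (∃ u : Torus.energySpace (Fin 3), IsLevel N u ∧
          MvPolynomial.eval (fun j => Torus.pairing u.1 (g j)) P ≠ 0) →
        0 < ∫ u, MvPolynomial.eval (fun j => Torus.pairing u.1 (g j)) P ∂μ₁) ∧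
      IsPolyStationary ν f N 3 μ₁ ∧
      (∀ a : UnitAddTorus (Fin 3), a 1 = 0 → L • a = 0 →
        ∀ (m : ℕ) (g : Fin m → UnitAddTorus (Fin 3) → EuclideanSpace ℝ (Fin 3)),
        (∀ i, IsBandTest N (g i)) →
        Measure.map (fun u : Torus.energySpace (Fin 3) => fun i => Torus.pairing u.1 (fun x => g i (x + a))) μ₁ =
          Measure.map (fun u : Torus.energySpace (Fin 3) => fun i => Torus.pairing u.1 (g i)) μ₁) ∧
      Torus.ensembleEnergy μ₁ = Torus.ensembleEnergy μ₀ ∧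
      Torus.ensembleDissipation ν μ₁ = Torus.ensembleDissipation ν μ₀ :=
  Summit.AnomalousDissipation.AnomalousDissipation.Theorems.MomentParityQuarticGate.stub_order3SurgerySym

/-- **S2c-centre — THE COMBINATORIAL CORE IN THE ZERO MOMENTUM SECTOR (registered sub-stub `cubicCoreCentre`).**
A complex tensor `Γ` on triples of nonzero lattice vectors in the ball `|k|² ≤ M` (`M = N²`), symmetric,
supported on triples summing to `0`, transversal in each slot, and satisfying the POLARISED QUARTET IDENTITY
(the Fourier form of `{C, B_N} = 0` for the cubic form `C` with coefficient tensor `Γ`; derived from the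
Casimir hypothesis by `noAxialCubicCasimir_of_cores`, LANDED p91709) vanishes on transversal arguments.
Proof plan (lead): inside-out induction on the longest leg — finite BASE (all legs `|k|² ≤ 5`, 1732
coordinates; killed by an explicit one- or two-term propagation schedule in the `nb` polarisation basis,
kernel-checked step by step) + uniform LAYER theorem (`|a|² = L ≥ 6`: small-spread antipodal families are
`B_a`-shaped by clean pairs and killed by a `b`-split; the rest by isolation, `cubicIsolation` LANDED p88752)
+ scaling for non-primitive equilateral layers. Evidence: nullity `0` for every `M ≤ 25` tested; the N-free
base and layers `6, 9, 10, …, 20` verified (compute/lead). Size L. -/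
theorem stub_cubicCoreCentre : ∀ (M : ℕ) (B : Finset (Fin 3 → ℤ)), 25 ≤ M → (∀ k, k ∈ B ↔ 0 < Literature.Analysis.FunctionSpaces.Torus.freqNormSq k ∧ Literature.Analysis.FunctionSpaces.Torus.freqNormSq k ≤ M) → ∀ Γ : (Fin 3 → ℤ) → (Fin 3 → ℤ) → (Fin 3 → ℤ) → Fin 3 → Fin 3 → Fin 3 → ℂ, (∀ p q r a b c, Γ p q r a b c = Γ q p r b a c) → (∀ p q r a b c, Γ p q r a b c = Γ p r q a c b) → (∀ p q r, (p ∉ B ∨ q ∉ B ∨ r ∉ B ∨ p + q + r ≠ 0) → ∀ a b c, Γ p q r a b c = 0) → (∀ p q r b c, ∑ a, Γ p q r a b c * (p a : ℂ) = 0) → (∀ (w : Fin 4 → Fin 3 → ℤ) (x : Fin 4 → Fin 3 → ℂ), (∀ i, w i ∈ B) → (∀ i, ∑ a, (w i a : ℂ) * x i a = 0) → ∑ p ∈ (Finset.univ : Finset (Fin 4 × Fin 4)).filter (fun p => p.1 < p.2), ∑ q ∈ (Finset.univ : Finset (Fin 4 × Fin 4)).filter (fun q => q.1 < q.2 ∧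 q.1 ≠ p.1 ∧ q.1 ≠ p.2 ∧ q.2 ≠ p.1 ∧ q.2 ≠ p.2), ∑ a, ∑ b, ∑ c, Γ (w p.1 + w p.2) (w q.1) (w q.2) a b c * ((∑ d, x p.1 d * (w p.2 d : ℂ)) * x p.2 a + (∑ d, x p.2 d * (w p.1 d : ℂ)) * x p.1 a) * x q.1 b * x q.2 c = 0) → ∀ (p q r : Fin 3 → ℤ) (x y z : Fin 3 → ℂ), (∑ a, (p a : ℂ) * x a = 0) → (∑ b, (q b : ℂ) * y b = 0) → (∑ c, (r c : ℂ) * z c = 0) → ∑ a, ∑ b, ∑ c, Γ p q r a b c * x a * y b * z c = 0 := by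
  sorry

/-- **S2c-axis — THE COMBINATORIAL CORE IN AN AXIAL SECTOR `(0,m,0)`, `m ≠ 0` (registered sub-stub
`cubicCoreOffCentre`).** Same as `stub_cubicCoreCentre` for triples summing to `θ = (0,m,0) ≠ 0`. Proof plan
(lead): OUTSIDE-IN isolation schedule seeded by the `θ`-leg triples `(θ; b, −b)` with `|2b|² > M`,
`|θ − 2b|² > M` (doubled quartet `{b, b, −b, θ−b}`), then block isolation inward (pure isolation kills every
axial sector at every `M ≤ 16` tested; the N-free inside-out variant does NOT work off-centre — nullity
232 at `L ≤ 6` — so the ball boundary is used, through inequalities only). Size M–L. -/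
theorem stub_cubicCoreOffCentre : ∀ (M : ℕ) (m : ℤ) (B : Finset (Fin 3 → ℤ)), 25 ≤ M → m ≠ 0 → (∀ k, k ∈ B ↔ 0 < Literature.Analysis.FunctionSpaces.Torus.freqNormSq k ∧ Literature.Analysis.FunctionSpaces.Torus.freqNormSq k ≤ M) → ∀ Γ : (Fin 3 → ℤ) → (Fin 3 → ℤ) → (Fin 3 → ℤ) → Fin 3 → Fin 3 → Fin 3 → ℂ, (∀ p q r a b c, Γ p q r a b c = Γ q p r b a c) → (∀ p q r a b c, Γ p q r a b c = Γ p r q a c b) → (∀ p q r, (p ∉ B ∨ q ∉ B ∨ r ∉ B ∨ p + q + r ≠ fun i => if i = 1 then m else 0) → ∀ a b c, Γ p q r a b c = 0) → (∀ p q r b c, ∑ a, Γ p q r a b c * (p a : ℂ) = 0) → (∀ (w : Fin 4 → Fin 3 → ℤ) (x : Fin 4 → Fin 3 → ℂ), (∀ i, w i ∈ B) → (∀ i, ∑ a, (w i a : ℂ) * x i a = 0) → ∑ p ∈ (Finset.univ : Finset (Fin 4 × Fin 4)).filter (fun p => p.1 < p.2), ∑ q ∈ (Finset.univ : Finset (Fin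 4 × Fin 4)).filter (fun q => q.1 < q.2 ∧ q.1 ≠ p.1 ∧ q.1 ≠ p.2 ∧ q.2 ≠ p.1 ∧ q.2 ≠ p.2), ∑ a, ∑ b, ∑ c, Γ (w p.1 + w p.2) (w q.1) (w q.2) a b c * ((∑ d, x p.1 d * (w p.2 d : ℂ)) * x p.2 a + (∑ d, x p.2 d * (w p.1 d : ℂ)) * x p.1 a) * x q.1 b * x q.2 c = 0) → ∀ (p q r : Fin 3 → ℤ) (x y z : Fin 3 → ℂ), (∑ a, (p a : ℂ) * x a = 0) → (∑ b, (q b : ℂ) * y b = 0) → (∑ c, (r c : ℂ) * z c = 0) → ∑ a, ∑ b, ∑ c, Γ p q r a b c * x a * y b * z c = 0 := by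
  sorry

/-- **S2c — NO AXIAL CUBIC CASIMIR at infinitely many levels (A3 of the card; replaces conjunct (i)
`NoCubicCasimir N` of the lead's `stub_casimirs`; THE CONJECTURAL STUB).** For frequently many `N`,
level-`N` Galerkin–Euler has no nonzero homogeneous CUBIC polynomial invariant that is invariant under
the finite shear translations `H_L`, `L > 3N` (by Nyquist, `|θ₀|, |θ₂| ≤ 3N < L`: equivalently no
`G′`-invariant one, equivalently none in an axial momentum sector `(0,m,0)`, `|m| ≤ 3N`).
Why plausibly true: folklore that truncated 3-D Euler has no invariant beyond `E`, `H` (Kraichnan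
1973; Cichowlas et al. arXiv:nlin/0410064 p. 4), here needed ONLY on the pencil `ℤe₁`, where the
sector count drops by `≍ N²` and chains never stall; exact evidence (item): cubic nullity 0 in the
sectors `0, (0,1,0), (0,2,0), (1,1,0)` for `0<|k|² ≤ M`, `M = 2, 3, 4, 5` (kit j012002; up to 1732
unknowns) and in 8 sectors incl. `(0,3,0), (0,4,0)` at level `N = 2` (kit j011010) — i.e. certified at
`N = 2` up to the near-empty top sectors `|m| = 5, 6`. FALSE at `N = 1` (`not_noCubicCasimir_one`),
harmless for `∃ᶠ`. Why it might fail: an accidental axial cubic invariant persisting at ALL large `N`.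
If it does, swap in the weaker `AxialCubicTransversality N` of card `cubic-transversality` (only S3′ and
S5b change). Size M–L. -/
theorem stub_noAxialCubicCasimir :
    ∃ᶠ N in atTop, ∀ L : ℕ, 3 * N < L →
    ∀ (m : ℕ) (g : Fin m → UnitAddTorus (Fin 3) → EuclideanSpace ℝ (Fin 3))
      (P : MvPolynomial (Fin m) ℝ), (∀ i, IsBandTest N (g i)) → P.IsHomogeneous 3 →
      (∀ a : UnitAddTorus (Fin 3), a 1 = 0 → L • a = 0 → ∀ u : Torus.energySpace (Fin 3), IsLevel N u →
        MvPolynomial.eval (fun j => Torus.pairing u.1 (fun x => g j (x + a))) P =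
          MvPolynomial.eval (fun j => Torus.pairing u.1 (g j)) P) →
      (∀ u : Torus.energySpace (Fin 3), IsLevel N u →
        Torus.nsGeneratorPairing (d := Fin 3) 0 0 u (polyGrad g P u) = 0) →
      ∀ u : Torus.energySpace (Fin 3), IsLevel N u →
        MvPolynomial.eval (fun j => Torus.pairing u.1 (g j)) P = 0 :=
  Summit.AnomalousDissipation.AnomalousDissipation.Theorems.MomentParityQuarticGate.noAxialCubicCasimir_of_cores
    stub_cubicCoreCentre stub_cubicCoreOffCentre

/-- **S3′ — THE LEVER AT ORDER 3: AXIAL DEFECT CERTIFICATE (the lead's S3 inside the invariant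
sub-algebra, de-averaged).** At a level `N` with no shear-invariant cubic Casimir (S2c at `N`, `H_L`-form), for a smooth
`G′`-invariant force and a level-`N` probability law `μ` with finite fourth moments and `H_L`-invariant
cylindrical statistics, `L > 3N`: finitely many level-`N` fields `vₗ` and weights `cₗ ≥ 0` with
`row_μ(p₃) + Σₗ cₗ {p₃,B_N}(vₗ) = 0` for every homogeneous cubic test `p₃` — the SAME certificate shape
the lead's S4 consumes.
Why true: `W` := homogeneous cubic polynomial functions on `V_N`; `ψ := −row_μ|_W` is a well-defined
linear functional, `H_L`-invariant (law invariance + `F(τ_a u) = τ_a F(u)`); the evaluation cone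
`C = cone{ev_v}` is `H_L`-stable (`ev_{τ_a v} = ev_v ∘ τ_a*`), so the finite averages
`π ev_v = L⁻² Σ_a ev_{τ_a v}` lie IN `C` (finitely many plain atoms — this is the de-averaging) and
span a cone `C^{H_L} ⊂ C ∩ (W*)^{H_L}`; its dual inside the `H_L`-invariant cubics is
`{p : {p,B_N} ≥ 0 on V_N}` (for invariant `p`, `(π ev_v)(p) = ev_v(p)`) = the `H_L`-invariant cubic
CASIMIRS by the sign lemma S1 — `MomentParityQuarticGate.stub_signLemma`, PROVED in tree — hence zero
by the hypothesis (stated in exactly this `H_L`-form); a convex cone with trivial dual is everything (`exists_conic_certificate` /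
`mem_hull_evalVectors`, landed), so `ψ = ψ ∘ π ∈ C^{H_L} ⊂ C`. Size M–L. -/
theorem stub_axialDefectCertificate :
    ∀ (N L : ℕ), 3 * N < L →
    (∀ (m : ℕ) (g : Fin m → UnitAddTorus (Fin 3) → EuclideanSpace ℝ (Fin 3))
      (P : MvPolynomial (Fin m) ℝ), (∀ i, IsBandTest N (g i)) → P.IsHomogeneous 3 →
      (∀ a : UnitAddTorus (Fin 3), a 1 = 0 → L • a = 0 → ∀ u : Torus.energySpace (Fin 3), IsLevel N u →
        MvPolynomial.eval (fun j => Torus.pairing u.1 (fun x => g j (x + a))) P =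
          MvPolynomial.eval (fun j => Torus.pairing u.1 (g j)) P) →
      (∀ u : Torus.energySpace (Fin 3), IsLevel N u →
        Torus.nsGeneratorPairing (d := Fin 3) 0 0 u (polyGrad g P u) = 0) →
      ∀ u : Torus.energySpace (Fin 3), IsLevel N u →
        MvPolynomial.eval (fun j => Torus.pairing u.1 (g j)) P = 0) →
    ∀ (ν : ℝ) (f : UnitAddTorus (Fin 3) → EuclideanSpace ℝ (Fin 3)), Torus.IsSmooth f →
    (∀ a : UnitAddTorus (Fin 3), a 1 = 0 → ∀ x, f (x + a) = f x) →
    ∀ μ : Measure (Torus.energySpace (Fin 3)), IsProbabilityMeasure μ → (∀ᵐ u ∂μ, IsLevel N u) →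
    Integrable (fun u : Torus.energySpace (Fin 3) => ‖u‖ ^ 4) μ →
    (∀ a : UnitAddTorus (Fin 3), a 1 = 0 → L • a = 0 →
      ∀ (m : ℕ) (g : Fin m → UnitAddTorus (Fin 3) → EuclideanSpace ℝ (Fin 3)),
      (∀ i, IsBandTest N (g i)) →
      Measure.map (fun u : Torus.energySpace (Fin 3) => fun i => Torus.pairing u.1 (fun x => g i (x + a))) μ =
        Measure.map (fun u : Torus.energySpace (Fin 3) => fun i => Torus.pairing u.1 (g i)) μ) →
    ∃ (M : ℕ) (v : Fin M → Torus.energySpace (Fin 3)) (c : Fin M → ℝ),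
      (∀ l, IsLevel N (v l)) ∧ (∀ l, 0 ≤ c l) ∧
      ∀ (m : ℕ) (g : Fin m → UnitAddTorus (Fin 3) → EuclideanSpace ℝ (Fin 3))
        (P : MvPolynomial (Fin m) ℝ), (∀ i, IsBandTest N (g i)) → P.IsHomogeneous 3 →
        ∫ u, Torus.nsGeneratorPairing ν f u (polyGrad g P u) ∂μ +
          ∑ l, c l * Torus.nsGeneratorPairing (d := Fin 3) 0 0 (v l) (polyGrad g P (v l)) = 0 :=
  Summit.AnomalousDissipation.AnomalousDissipation.Theorems.MomentParityQuarticGate.stub_axialDefectCertificate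

/-- **S4 — EXACT FAR-ATOM SURGERY AT ORDER 4 — CLOSED: now the landed theorem
`MomentParityQuarticGate.stub_surgery` (Theorems/MomentParityQuarticGateSurgery.lean, p79998, r-0). VERBATIM the lead's registered stub `stub_surgery` of
`Lines/recession-cone.lean` (skeleton b49af609…; SHARED between the two lines, statement byte-for-byte,
fully unfolded).** A level-`N` probability law `μ₀` with finite fourth moments and STRICTLY positive
degree-4 Riesz functional on `V_N` (Slater), 3-stationary at `(ν,f,N)`, plus a defect certificate
`(vᵢ,cᵢ)` ⟹ a level-`N` probability law, finite fourth moments, 4-STATIONARY, same mean energy and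
dissipation. Why true: `w := R⁻⁴Σcᵢ`, `μ := (1−w)μ₀' + Σᵢ cᵢR⁻⁴·½(δ_{Rvᵢ}+δ_{−Rvᵢ})`, `μ₀'` realising
the pre-corrected moments `(1, M₁, M₂ − R⁻²Σcᵢvᵢvᵢᵀ, M₃, M₄)(μ₀)/(1−w)` (strict positivity is open;
Fialkow–Nie, PROVED; `exists_isStrictlyKPositive_nhds`, `exists_surgery_radius` landed). No symmetry is
needed downstream of S3′ — that is the point of de-averaging the certificate. Size L. -/
theorem stub_surgery :
    ∀ (ν : ℝ) (f : UnitAddTorus (Fin 3) → EuclideanSpace ℝ (Fin 3)) (N : ℕ) (μ₀ : Measure (Torus.energySpace (Fin 3))),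
    Torus.IsSmooth f → IsProbabilityMeasure μ₀ → (∀ᵐ u ∂μ₀, (∀ k ∉ (Torus.freqBall N).erase (0 : Fin 3 → ℤ),
          UnitAddTorus.mFourierCoeff (EuclideanSpace.complexify ∘ (u.1 : UnitAddTorus (Fin 3) → EuclideanSpace ℝ (Fin 3))) k = 0)) →
    Integrable (fun u : Torus.energySpace (Fin 3) => ‖u‖ ^ 4) μ₀ →
    (∀ (m : ℕ) (g : Fin m → UnitAddTorus (Fin 3) → EuclideanSpace ℝ (Fin 3))
      (P : MvPolynomial (Fin m) ℝ),
      (∀ i, (Torus.IsSmooth (g i) ∧ Torus.IsDivFree (g i) ∧ Torus.HasZeroMean (g i) ∧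
        ∀ k ∉ (Torus.freqBall N).erase (0 : Fin 3 → ℤ),
          UnitAddTorus.mFourierCoeff (EuclideanSpace.complexify ∘ (g i)) k = 0)) → P.totalDegree ≤ 4 →
      (∀ u : Torus.energySpace (Fin 3), (∀ k ∉ (Torus.freqBall N).erase (0 : Fin 3 → ℤ),
          UnitAddTorus.mFourierCoeff (EuclideanSpace.complexify ∘ (u.1 : UnitAddTorus (Fin 3) → EuclideanSpace ℝ (Fin 3))) k = 0) →
        0 ≤ MvPolynomial.eval (fun j => Torus.pairing u.1 (g j)) P) →
      (∃ u : Torus.energySpace (Fin 3), (∀ k ∉ (Torus.freqBall N).erase (0 : Fin 3 → ℤ),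
          UnitAddTorus.mFourierCoeff (EuclideanSpace.complexify ∘ (u.1 : UnitAddTorus (Fin 3) → EuclideanSpace ℝ (Fin 3))) k = 0) ∧
        MvPolynomial.eval (fun j => Torus.pairing u.1 (g j)) P ≠ 0) →
      0 < ∫ u, MvPolynomial.eval (fun j => Torus.pairing u.1 (g j)) P ∂μ₀) →
    (∀ (m : ℕ) (g : Fin m → UnitAddTorus (Fin 3) → EuclideanSpace ℝ (Fin 3))
      (P : MvPolynomial (Fin m) ℝ),
      (∀ i, (Torus.IsSmooth (g i) ∧ Torus.IsDivFree (g i) ∧ Torus.HasZeroMean (g i) ∧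
        ∀ k ∉ (Torus.freqBall N).erase (0 : Fin 3 → ℤ),
          UnitAddTorus.mFourierCoeff (EuclideanSpace.complexify ∘ (g i)) k = 0)) → P.totalDegree + 1 ≤ 3 →
      Integrable (fun u : Torus.energySpace (Fin 3) => Torus.nsGeneratorPairing ν f u
          (fun x => ∑ i, (MvPolynomial.eval (fun j => Torus.pairing u.1 (g j))
            (MvPolynomial.pderiv i P)) • g i x)) μ₀ ∧
      ∫ u, Torus.nsGeneratorPairing ν f u
          (fun x => ∑ i, (MvPolynomial.eval (fun j => Torus.pairing u.1 (g j))
            (MvPolynomial.pderiv i P)) • g i x) ∂μ₀ = 0) →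
    ∀ (M : ℕ) (v : Fin M → Torus.energySpace (Fin 3)) (c : Fin M → ℝ),
    ((∀ l, (∀ k ∉ (Torus.freqBall N).erase (0 : Fin 3 → ℤ),
          UnitAddTorus.mFourierCoeff (EuclideanSpace.complexify ∘ ((v l).1 : UnitAddTorus (Fin 3) → EuclideanSpace ℝ (Fin 3))) k = 0)) ∧ (∀ l, 0 ≤ c l) ∧
      ∀ (m : ℕ) (g : Fin m → UnitAddTorus (Fin 3) → EuclideanSpace ℝ (Fin 3))
      (P : MvPolynomial (Fin m) ℝ),
      (∀ i, (Torus.IsSmooth (g i) ∧ Torus.IsDivFree (g i) ∧ Torus.HasZeroMean (g i) ∧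
        ∀ k ∉ (Torus.freqBall N).erase (0 : Fin 3 → ℤ),
          UnitAddTorus.mFourierCoeff (EuclideanSpace.complexify ∘ (g i)) k = 0)) → P.IsHomogeneous 3 →
      ∫ u, Torus.nsGeneratorPairing ν f u
          (fun x => ∑ i, (MvPolynomial.eval (fun j => Torus.pairing u.1 (g j))
            (MvPolynomial.pderiv i P)) • g i x) ∂μ₀ +
        ∑ l, c l * Torus.nsGeneratorPairing (d := Fin 3) 0 0 (v l)
          (fun x => ∑ i, (MvPolynomial.eval (fun j => Torus.pairing (v l).1 (g j))
            (MvPolynomial.pderiv i P)) • g i x) = 0) →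
    ∃ μ : Measure (Torus.energySpace (Fin 3)), IsProbabilityMeasure μ ∧ (∀ᵐ u ∂μ, (∀ k ∉ (Torus.freqBall N).erase (0 : Fin 3 → ℤ),
          UnitAddTorus.mFourierCoeff (EuclideanSpace.complexify ∘ (u.1 : UnitAddTorus (Fin 3) → EuclideanSpace ℝ (Fin 3))) k = 0)) ∧
      Integrable (fun u : Torus.energySpace (Fin 3) => ‖u‖ ^ 4) μ ∧
      (∀ (m : ℕ) (g : Fin m → UnitAddTorus (Fin 3) → EuclideanSpace ℝ (Fin 3))
      (P : MvPolynomial (Fin m) ℝ),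
      (∀ i, (Torus.IsSmooth (g i) ∧ Torus.IsDivFree (g i) ∧ Torus.HasZeroMean (g i) ∧
        ∀ k ∉ (Torus.freqBall N).erase (0 : Fin 3 → ℤ),
          UnitAddTorus.mFourierCoeff (EuclideanSpace.complexify ∘ (g i)) k = 0)) → P.totalDegree + 1 ≤ 4 →
      Integrable (fun u : Torus.energySpace (Fin 3) => Torus.nsGeneratorPairing ν f u
          (fun x => ∑ i, (MvPolynomial.eval (fun j => Torus.pairing u.1 (g j))
            (MvPolynomial.pderiv i P)) • g i x)) μ ∧
      ∫ u, Torus.nsGeneratorPairing ν f u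
          (fun x => ∑ i, (MvPolynomial.eval (fun j => Torus.pairing u.1 (g j))
            (MvPolynomial.pderiv i P)) • g i x) ∂μ = 0) ∧
      Torus.ensembleEnergy μ = Torus.ensembleEnergy μ₀ ∧
      Torus.ensembleDissipation ν μ = Torus.ensembleDissipation ν μ₀ :=
  Summit.AnomalousDissipation.AnomalousDissipation.Theorems.MomentParityQuarticGate.stub_surgery


/-! ## The composition (kernel-checked, no `sorry` of its own) -/

/-- **`QuarticGate` from the seven stubs.** Take `f, E, ε, ν₀` from S6′ and `ν_j := ν₀/(j+2)`
(positive, `< ν₀`, `→ 0`). At each `j`: S6′ gives `N₀`; S2c's frequently-many levels meet `N ≥ N₀` and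
`N ≥ 2` (`Frequently.and_eventually`); at such `N`, with `L := 3N + 1`, S6′ gives the symmetric loud
order-2 design `μ₀`, S2q + S5a kill every quadratic Casimir row, S5b gives a symmetric Slater
3-stationary `μ₁` with the same energy/dissipation, S3′ (fed S2c at `N`) a plain defect certificate for
`μ₁`, and S4 the 4-stationary `μ` with energy `≤ E` and dissipation `≥ ε`. -/
theorem QuarticGate_of : QuarticGate := by
  obtain ⟨f, hfs, hfd, hfz, hfsym, E, ε, ν₀, hε, hν₀, hK1⟩ := stub_order2DesignSym
  have hνpos : ∀ j : ℕ, 0 < ν₀ / ((j : ℝ) + 2) := fun j => div_pos hν₀ (by positivity)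
  have hνlt : ∀ j : ℕ, ν₀ / ((j : ℝ) + 2) < ν₀ := fun j => by
    rw [div_lt_iff₀ (by positivity)]
    nlinarith [(Nat.cast_nonneg j : (0 : ℝ) ≤ j)]
  have hνlim : Tendsto (fun j : ℕ => ν₀ / ((j : ℝ) + 2)) atTop (nhds 0) :=
    tendsto_const_nhds.div_atTop
      (tendsto_atTop_add_const_right atTop (2 : ℝ) tendsto_natCast_atTop_atTop)
  refine ⟨f, hfs, hfd, hfz, fun j => ν₀ / ((j : ℝ) + 2), E, ε, hνpos, hνlim, hε, fun j => ?_⟩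
  obtain ⟨N₀, hN₀⟩ := hK1 _ (hνpos j) (hνlt j)
  refine (stub_noAxialCubicCasimir.and_eventually
    ((eventually_ge_atTop N₀).and (eventually_ge_atTop 2))).mono ?_
  rintro N ⟨hCub, hN, h2⟩
  obtain ⟨μ₀, hp₀, hl₀, hR₀, hnd₀, hsym₀, hlin₀, hErow₀, hHrow₀, hE₀, hD₀⟩ :=
    hN₀ N hN (3 * N + 1) (Nat.succ_pos _)
  have hQuad := stub_axialQuadRigidity N h2 (3 * N + 1) (by omega)
  have hCas := stub_axialDefect _ f N (3 * N + 1) μ₀ hfs hfsym (by omega) hp₀ hl₀ hR₀ hsym₀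
    hErow₀ hHrow₀ hQuad
  obtain ⟨μ₁, hp₁, hl₁, hi₁, hsl₁, hst₁, hsym₁, hE₁, hD₁⟩ :=
    stub_order3SurgerySym _ f N (3 * N + 1) μ₀ hfs hfsym (Nat.succ_pos _) hp₀ hl₀ hR₀ hnd₀ hsym₀
      hlin₀ (fun m g P hg hP hC => (hCas m g P hg hP hC).2)
  obtain ⟨M, v, c, hcert⟩ :=
    stub_axialDefectCertificate N (3 * N + 1) (by omega) (hCub (3 * N + 1) (by omega)) _ f hfs
      hfsym μ₁ hp₁ hl₁ hi₁ hsym₁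
  obtain ⟨μ, hp, hl, hi, hst, hE, hD⟩ :=
    stub_surgery _ f N μ₁ hfs hp₁ hl₁ hi₁ hsl₁ hst₁ M v c hcert
  refine ⟨μ, hp, hl, hi, hst, ?_, ?_⟩
  · rw [hE, hE₁]; exact hE₀
  · rw [hD, hD₁]; exact hD₀

end Summit.AnomalousDissipation.AnomalousDissipation.Cruxes.QuarticGate.AxisSectors
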